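import Summits.ValiantsHypothesis.ValiantsHypothesis.Theorems.LacunarySymmetroidMatrixDescartesCensusMirror

/-!
# `MatrixDescartes` census — the ONE-SIGN SEMIDEFINITE WORD: a pencil whose letters are all positive semidefinite has NO positive root

HONEST FRAMING.  Object-search cell `pub-symmetroid`; beside the OPEN typed statement `DoorA34 = PosRootLawAt 3 4 18` (route item
`Theses.LacunarySymmetroid.DoorA34`, stmt-ValiantsHypothesis-19980).  Engine-2's LP34 table kills the all-definite words (`DDDD`, …) by LP;
the direct reason is elementary and holds for EVERY format and support: if every letter `S l` is positive SEMIdefinite, then for `t > 0`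
the matrix `∑ l, t^(d l) • S l` is positive semidefinite, and a kernel vector at one `t₀ > 0` is a common kernel vector of all letters
(`v* S l v = 0 ⇒ S l v = 0`), hence a kernel vector at every `t` — so `det (∑ X^(d l) • S l)` is either the zero polynomial or has no positive
root; either way the counted number of distinct positive roots is `0` (`card_posRoots_eq_zero_of_posSemidef`; negative semidefinite letters by
`S ↦ −S`, `card_posRoots_eq_zero_of_negSemidef`).  Mixed-sign definite words are NOT covered (they do carry roots).  Nothing here bears on the
all-indefinite residue of `DoorA34`, on `ζ_sym(3,4)`, on `MatrixDescartes` (stmt-ValiantsHypothesis-18050) or `VP ≠ VNP`.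

[folklore] Elementary linear algebra.
-/

-- `Summit.ValiantsHypothesis.ValiantsHypothesis.…` repeats a component by the D-0017 layout
-- (single-conjunct summit), which the `dupNamespace` linter flags; the name is mandated.
set_option linter.dupNamespace false

namespace Summit.ValiantsHypothesis.ValiantsHypothesis.Theorems.LacunarySymmetroidMatrixDescartes.Census

open Polynomial Matrix Finset
open scoped BigOperators Polynomial Matrix

/-- A nonnegative combination of positive semidefinite real matrices is positive semidefinite. [folklore] -/
theorem posSemidef_sum_smul {m K : ℕ} (S : Fin K → Matrix (Fin m) (Fin m) ℝ) (hS : ∀ l, (S l).PosSemidef)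
    (c : Fin K → ℝ) (hc : ∀ l, 0 ≤ c l) : (∑ l, c l • S l).PosSemidef := by
  induction (Finset.univ : Finset (Fin K)) using Finset.induction_on with
  | empty => simpa using Matrix.PosSemidef.zero
  | @insert a s ha ih =>
    rw [Finset.sum_insert ha]
    exact ((hS a).smul (hc a)).add ih

/-- **Common kernel.**  If every `S l` is positive semidefinite, `c l > 0`, and `(∑ l, c l • S l) v = 0`, then `S l v = 0` for every `l`. [folklore] -/
theorem mulVec_eq_zero_of_posSemidef_sum {m K : ℕ} (S : Fin K → Matrix (Fin m) (Fin m) ℝ) (hS : ∀ l, (S l).PosSemidef)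
    (c : Fin K → ℝ) (hc : ∀ l, 0 < c l) {v : Fin m → ℝ} (hv : (∑ l, c l • S l) *ᵥ v = 0) (l : Fin K) :
    S l *ᵥ v = 0 := by
  -- the quadratic forms `c l · v* S l v` are nonnegative and sum to zero
  have hq : ∀ l', 0 ≤ c l' * (star v ⬝ᵥ (S l' *ᵥ v)) := fun l' =>
    mul_nonneg (hc l').le ((hS l').dotProduct_mulVec_nonneg v)
  have hsum : ∑ l', c l' * (star v ⬝ᵥ (S l' *ᵥ v)) = 0 := by
    have h0 : star v ⬝ᵥ ((∑ l', c l' • S l') *ᵥ v) = 0 := by rw [hv, dotProduct_zero]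
    rw [Matrix.sum_mulVec, dotProduct_sum] at h0
    simpa [Matrix.smul_mulVec, dotProduct_smul, smul_eq_mul] using h0
  have hl : c l * (star v ⬝ᵥ (S l *ᵥ v)) = 0 :=
    (Finset.sum_eq_zero_iff_of_nonneg (fun l' _ => hq l')).1 hsum l (Finset.mem_univ _)
  have hl' : star v ⬝ᵥ (S l *ᵥ v) = 0 := by
    rcases mul_eq_zero.1 hl with h | h
    · exact absurd h (hc l).ne'
    · exact h
  exact ((hS l).dotProduct_mulVec_zero_iff v).1 hl'

/-- **The one-sign semidefinite word has no positive root** (every format, every support): if all letters are positive semidefinite,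
`det (∑ l, X^(d l) • S l)` has no positive root to count (it is the zero polynomial as soon as it vanishes at one `t > 0`). [folklore] -/
theorem card_posRoots_eq_zero_of_posSemidef {m K : ℕ} (d : Fin K → ℕ) (S : Fin K → Matrix (Fin m) (Fin m) ℝ)
    (hS : ∀ l, (S l).PosSemidef) :
    ((∑ l, (X : ℝ[X]) ^ d l • (S l).map C).det.roots.toFinset.filter (fun t => 0 < t)).card = 0 := by
  classical
  rw [Finset.card_eq_zero, Finset.filter_eq_empty_iff]
  intro t ht ht0
  rw [Multiset.mem_toFinset] at ht
  have hP : (∑ l, (X : ℝ[X]) ^ d l • (S l).map C).det ≠ 0 := (Polynomial.mem_roots'.1 ht).1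
  have hroot : ((∑ l, (X : ℝ[X]) ^ d l • (S l).map C).det).eval t = 0 := (Polynomial.mem_roots'.1 ht).2
  -- a kernel vector at `t`
  rw [eval_det_pencil_eq] at hroot
  obtain ⟨v, hv0, hv⟩ := (Matrix.exists_mulVec_eq_zero_iff).2 hroot
  have hker : ∀ l, S l *ᵥ v = 0 :=
    mulVec_eq_zero_of_posSemidef_sum S hS (fun l => t ^ d l) (fun l => pow_pos ht0 _) hv
  -- hence a kernel vector at every point: the determinant vanishes identically
  apply hP
  apply Polynomial.funext
  intro s
  rw [eval_det_pencil_eq, Polynomial.eval_zero]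
  apply (Matrix.exists_mulVec_eq_zero_iff).1
  refine ⟨v, hv0, ?_⟩
  rw [Matrix.sum_mulVec]
  exact Finset.sum_eq_zero fun l _ => by rw [Matrix.smul_mulVec, hker l, smul_zero]

/-- The same for NEGATIVE semidefinite letters (`S ↦ −S` multiplies the determinant by `(−1)^m`). [folklore] -/
theorem card_posRoots_eq_zero_of_negSemidef {m K : ℕ} (d : Fin K → ℕ) (S : Fin K → Matrix (Fin m) (Fin m) ℝ)
    (hS : ∀ l, (-S l).PosSemidef) :
    ((∑ l, (X : ℝ[X]) ^ d l • (S l).map C).det.roots.toFinset.filter (fun t => 0 < t)).card = 0 := by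
  have h := card_posRoots_eq_zero_of_posSemidef d (fun l => -S l) hS
  have hneg : (∑ l, (X : ℝ[X]) ^ d l • (-S l).map C) = -(∑ l, (X : ℝ[X]) ^ d l • (S l).map C) := by
    rw [← Finset.sum_neg_distrib]
    refine Finset.sum_congr rfl fun l _ => ?_
    rw [Matrix.map_neg _ (map_neg C), smul_neg]
  rw [hneg, Matrix.det_neg, ← C_1, ← C_neg, ← map_pow, Polynomial.roots_C_mul _ (by simp)] at h
  exact h

/-- Row currency, `(3,4)`: the words `DDDD` with one sign carry no positive root at all (so certainly `≤ 18`). [folklore] -/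
theorem doorA34_on_posSemidef_word (d : Fin 4 → ℕ) (S : Fin 4 → Matrix (Fin 3) (Fin 3) ℝ) (hS : ∀ l, (S l).PosSemidef) :
    ((∑ l, (X : ℝ[X]) ^ d l • (S l).map C).det.roots.toFinset.filter (fun t => 0 < t)).card ≤ 18 := by
  rw [card_posRoots_eq_zero_of_posSemidef d S hS]
  exact Nat.zero_le _

end Summit.ValiantsHypothesis.ValiantsHypothesis.Theorems.LacunarySymmetroidMatrixDescartes.Census
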